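import Mathlib.Analysis.Calculus.BumpFunction.Normed
import Mathlib.Analysis.Calculus.BumpFunction.InnerProduct
import Literature.Analysis.FluidPDE.TransversePeriodization
import HarnessLib

/-!
# Transverse profiles with the moment conditions (3.5) of De Lellis–Kwon 2022:
# `⟨ψ⟩ = ⟨ψ³⟩ = 0, ⟨ψ²⟩ = 1` and `⟨ψ⟩ = 0, ⟨ψ³⟩ = 1`, concentrated near a point of `𝕋²`

Analysis/FluidPDE support file on the discharge path of `Torus.DeLellisKwon2022_thm11`
(everything proved; no named facts). De Lellis–Kwon, Anal. PDE 15 (2022) = arXiv:2006.06482, §3.1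
(3.5)–(3.6), impose on the Mikado profiles `ψ_f` (functions on `𝕋³` constant along `f`)

> `⟨ψ_f⟩ = ⟨ψ_f³⟩ = 0`, `⟨ψ_f²⟩ = 1` for `f ∈ 𝓕^{j,R}`;  `⟨ψ_f⟩ = 0`, `⟨ψ_f³⟩ = 1` for `f ∈ 𝓕^{j,φ}`,
> `supp ψ_f ⊂ B(l_f, η/10)`

("the different moment conditions will play a major role": the `R`-profiles cancel the stress, the
`φ`-profiles cancel the unsolved flux current). Since `ψ_f` will be the pull-back `G ∘ L_f` of a
profile `G` on `𝕋²` along a measure-preserving transverse map (`LineDatum.integral_pull_pow`,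
`LinePullback`), it suffices to produce the TRANSVERSE profiles `G` on `𝕋²` with these moments and
with support in an arbitrarily small neighbourhood of a point. This file does so, in the framework
of the tree's `Transverse.conc` (`TransversePeriodization`: periodisation of `κ₀ · rescale a μ f₀` for a
Euclidean profile `f₀` with `tsupport ⊆ B̄(c₀, 1/4)`, `c₀ = (½, ½)`, `μ ≥ 1`):

* `DLK.motherBump` / `DLK.gb` — a normalised smooth bump `g ≥ 0` on `ℝ²` (`∫ g = 1`,
  `supp g = B(0, 1/20)`, `∫ g² > 0`, `∫ g³ > 0`);
* `DLK.profR = g(· - c₀ - e) - g(· - c₀ + e)`, `DLK.profPhi = 2g(· - c₀ - e) - g(· - c₀ + e) - g(· - c₀ - e')`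
  (`e = (1/8, 0)`, `e' = (0, 1/8)`; pairwise disjoint supports) — Euclidean profiles
  (`Transverse.IsProfile`) with **`∫ profR = ∫ profR³ = 0`, `∫ profR² = 2∫g² > 0`** and
  **`∫ profPhi = 0`, `∫ profPhi³ = 6∫g³ > 0`** (translation invariance; the cross terms vanish
  pointwise);
* `DLK.transR μ = conc κ_R 0 μ profR`, `DLK.transPhi μ = conc κ_φ 0 μ profPhi` with
  `κ_R = μ (∫profR²)^{-1/2}`, `κ_φ = (μ²/∫profPhi³)^{1/3}` — **the transverse profiles on `𝕋²`**:
  smooth, **`∫ transR = ∫ transR³ = 0`, `∫ transR² = 1`; `∫ transPhi = 0`, `∫ transPhi³ = 1`**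
  (`μ ≥ 1`), and **small support**: a nonzero value at `x ∈ 𝕋²` forces `x = proj w` with
  `‖w - c₀‖ ≤ 1/(4μ)` (`DLK.exists_lift_of_transR_ne_zero`, `…transPhi…`) — the hypothesis shape of
  the tube lemma `LineDatum.exists_dist_geodesic_le_of_pull_ne_zero` (`LineGeodesic`).

## Mathlib / tree search

Mathlib: `ContDiffBump.normed` (`integral_normed`, `support_normed_eq`, `tsupport_normed_eq`,
`contDiff_normed`, `nonneg_normed`), `integral_sub_right_eq_self`, `integral_pos_iff_support_of_nonneg`.
Tree: `Transverse.conc/IsProfile/conc_apply/isSmooth_conc/integral_conc/integral_comp_conc/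
tsupport_rescale_subset/integral_rescale` (`TransverseProfile`, `TransversePeriodization`), whose own
profiles `psiT` have `∫ψ = 0`, `∫ψ² = 1` but no control of `∫ψ³` (`lean search 'integral.*\\^ 3|third moment'`).

## References

* C. De Lellis, H. Kwon, Anal. PDE 15 (2022) = arXiv:2006.06482, §3.1 (3.5)–(3.6). [DelellisKwon2022]
-/

noncomputable section

open Set Filter Topology Function MeasureTheory Metric
open scoped ContDiff

namespace Literature.Analysis.FluidPDE

namespace DLK

open Transverse FunctionSpaces FunctionSpaces.Torus

/-- The Euclidean plane `ℝ²`, local notation. -/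
local notation "E²" => EuclideanSpace ℝ (Fin 2)

/-! ## The mother bump -/

/-- A smooth bump centred at `0 ∈ ℝ²`, equal to `1` on `B̄(0, 1/40)` and supported in `B(0, 1/20)`. [folklore] -/
def motherBump : ContDiffBump (0 : E²) := ⟨1 / 40, 1 / 20, by norm_num, by norm_num⟩

/-- `g = motherBump.normed`: smooth, `≥ 0`, `∫ g = 1`, `supp g = B(0, 1/20)`. [folklore] -/
def gb (z : E²) : ℝ := motherBump.normed volume z

/-- `g ≥ 0`. [folklore] -/
theorem gb_nonneg (z : E²) : 0 ≤ gb z := motherBump.nonneg_normed z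

/-- `g` is smooth. [folklore] -/
theorem contDiff_gb : ContDiff ℝ ∞ gb := motherBump.contDiff_normed

/-- `g` is continuous. [folklore] -/
theorem continuous_gb : Continuous gb := motherBump.continuous_normed

/-- `∫ g = 1`. [folklore] -/
theorem integral_gb : ∫ z, gb z = 1 := motherBump.integral_normed

/-- `supp g = B(0, 1/20)`. [folklore] -/
theorem support_gb : Function.support gb = ball (0 : E²) (1 / 20) := motherBump.support_normed_eq

/-- `tsupport g = B̄(0, 1/20)`. [folklore] -/
theorem tsupport_gb : tsupport gb = closedBall (0 : E²) (1 / 20) := motherBump.tsupport_normed_eq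

/-- `g z ≠ 0 → ‖z‖ < 1/20`. [folklore] -/
theorem norm_lt_of_gb_ne_zero {z : E²} (h : gb z ≠ 0) : ‖z‖ < 1 / 20 := by
  have : z ∈ Function.support gb := h
  rw [support_gb, mem_ball, dist_zero_right] at this
  exact this

/-- `g` has compact support. [folklore] -/
theorem hasCompactSupport_gb : HasCompactSupport gb := motherBump.hasCompactSupport_normed

/-- The powers `g^p`, `p ≥ 1`, have positive integral (`g ≥ 0` is continuous and positive near `0`). [folklore] -/
theorem integral_gb_pow_pos {p : ℕ} (hp : p ≠ 0) : 0 < ∫ z, gb z ^ p := by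
  have hint : Integrable (fun z => gb z ^ p) :=
    (continuous_gb.pow p).integrable_of_hasCompactSupport
      (hasCompactSupport_gb.comp_left (g := fun x : ℝ => x ^ p) (zero_pow hp))
  rw [integral_pos_iff_support_of_nonneg (fun z => pow_nonneg (gb_nonneg z) p) hint]
  have hsupp : Function.support (fun z => gb z ^ p) = ball (0 : E²) (1 / 20) := by
    rw [Function.support_pow _ hp, support_gb]
  rw [hsupp]
  exact measure_ball_pos _ _ (by norm_num)

/-! ## Translates with disjoint supports -/

/-- The horizontal offset `e = (1/8, 0)`. [folklore] -/
def offH : E² := EuclideanSpace.single 0 (1 / 8)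

/-- The vertical offset `e' = (0, 1/8)`. [folklore] -/
def offV : E² := EuclideanSpace.single 1 (1 / 8)

/-- `‖e‖ = 1/8`. [folklore] -/
theorem norm_offH : ‖offH‖ = 1 / 8 := by
  rw [offH, PiLp.norm_single, Real.norm_of_nonneg (by norm_num)]

/-- `‖e'‖ = 1/8`. [folklore] -/
theorem norm_offV : ‖offV‖ = 1 / 8 := by
  rw [offV, PiLp.norm_single, Real.norm_of_nonneg (by norm_num)]

/-- `‖e - (-e)‖ = 1/4`. [folklore] -/
theorem norm_offH_add_offH : ‖offH + offH‖ = 1 / 4 := by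
  rw [← two_smul ℝ offH, norm_smul, norm_offH]; norm_num

/-- `‖e - e'‖² = 1/32` (so `‖e - e'‖ ≥ 1/10`). [folklore] -/
theorem norm_offH_sub_offV : 1 / 10 ≤ ‖offH - offV‖ := by
  have h : ‖offH - offV‖ ^ 2 = 1 / 32 := by
    rw [EuclideanSpace.norm_sq_eq, Fin.sum_univ_two]
    simp [offH, offV]
    norm_num
  nlinarith [norm_nonneg (offH - offV)]

/-- `‖-e - e'‖ ≥ 1/10`. [folklore] -/
theorem norm_neg_offH_sub_offV : 1 / 10 ≤ ‖-offH - offV‖ := by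
  have h : ‖-offH - offV‖ ^ 2 = 1 / 32 := by
    rw [EuclideanSpace.norm_sq_eq, Fin.sum_univ_two]
    simp [offH, offV]
    norm_num
  nlinarith [norm_nonneg (-offH - offV)]

/-- **Disjointness of translates**: `g(z - a) g(z - b) = 0` whenever `‖a - b‖ ≥ 1/10`. [folklore] -/
theorem gb_mul_gb_eq_zero {a b : E²} (hab : 1 / 10 ≤ ‖a - b‖) (z : E²) : gb (z - a) * gb (z - b) = 0 := by
  by_contra h
  obtain ⟨ha, hb⟩ := mul_ne_zero_iff.1 h
  have h1 := norm_lt_of_gb_ne_zero ha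
  have h2 := norm_lt_of_gb_ne_zero hb
  have : ‖a - b‖ < 1 / 10 := by
    calc ‖a - b‖ = ‖(z - b) - (z - a)‖ := by abel_nf
      _ ≤ ‖z - b‖ + ‖z - a‖ := norm_sub_le _ _
      _ < 1 / 20 + 1 / 20 := add_lt_add h2 h1
      _ = 1 / 10 := by norm_num
  linarith

/-! ## The Euclidean profiles -/

/-- The translate `g_v = g(· - c₀ - v)` of the mother bump to `c₀ + v`. [folklore] -/
def gbAt (v : E²) (z : E²) : ℝ := gb (z - centre (Fin 2) - v)

/-- `g_v(z) = g(z - (c₀ + v))`. [folklore] -/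
theorem gbAt_apply (v z : E²) : gbAt v z = gb (z - (centre (Fin 2) + v)) := by
  rw [gbAt, sub_sub]

/-- Translates are smooth. [folklore] -/
theorem contDiff_gbAt (v : E²) : ContDiff ℝ ∞ (gbAt v) := by
  unfold gbAt; exact contDiff_gb.comp ((contDiff_id.sub contDiff_const).sub contDiff_const)

/-- Translates are continuous. [folklore] -/
theorem continuous_gbAt (v : E²) : Continuous (gbAt v) := (contDiff_gbAt v).continuous

/-- `∫ g_v^p = ∫ g^p` (translation invariance). [folklore] -/
theorem integral_gbAt_pow (v : E²) (p : ℕ) : ∫ z, gbAt v z ^ p = ∫ z, gb z ^ p := by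
  simp_rw [gbAt_apply]
  exact integral_sub_right_eq_self (fun z => gb z ^ p) (centre (Fin 2) + v)

/-- `tsupport g_v ⊆ B̄(c₀, ‖v‖ + 1/20)`. [folklore] -/
theorem tsupport_gbAt_subset (v : E²) : tsupport (gbAt v) ⊆ closedBall (centre (Fin 2)) (‖v‖ + 1 / 20) := by
  refine closure_minimal (fun z hz => ?_) isClosed_closedBall
  have h := norm_lt_of_gb_ne_zero (mem_support.1 hz)
  rw [mem_closedBall, dist_eq_norm]
  calc ‖z - centre (Fin 2)‖ = ‖(z - centre (Fin 2) - v) + v‖ := by abel_nf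
    _ ≤ ‖z - centre (Fin 2) - v‖ + ‖v‖ := norm_add_le _ _
    _ ≤ 1 / 20 + ‖v‖ := by linarith [h.le]
    _ = ‖v‖ + 1 / 20 := add_comm _ _

/-- Disjointness of translates in the `gbAt` form. [folklore] -/
theorem gbAt_mul_gbAt_eq_zero {a b : E²} (hab : 1 / 10 ≤ ‖a - b‖) (z : E²) : gbAt a z * gbAt b z = 0 := by
  rw [gbAt_apply, gbAt_apply]
  have := gb_mul_gb_eq_zero (a := centre (Fin 2) + a) (b := centre (Fin 2) + b) (by simpa using hab) z
  exact this

/-- **The `R`-type Euclidean profile** `profR = g_e - g_{-e}` (`e = (1/8, 0)`). [cite: DelellisKwon2022, §3.1 (3.5), first line] -/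
def profR (z : E²) : ℝ := gbAt offH z - gbAt (-offH) z

/-- **The `φ`-type Euclidean profile** `profPhi = 2g_e - g_{-e} - g_{e'}`. [cite: DelellisKwon2022, §3.1 (3.5), second line] -/
def profPhi (z : E²) : ℝ := 2 * gbAt offH z - gbAt (-offH) z - gbAt offV z

/-- `profR` is a transverse profile: smooth with `tsupport ⊆ B̄(c₀, 1/4)`. [folklore] -/
theorem isProfile_profR : IsProfile profR := by
  refine ⟨(contDiff_gbAt _).sub (contDiff_gbAt _), ?_⟩
  refine (tsupport_sub (gbAt offH) (gbAt (-offH))).trans (union_subset ?_ ?_)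
  · refine (tsupport_gbAt_subset _).trans (closedBall_subset_closedBall ?_)
    rw [norm_offH]; norm_num
  · refine (tsupport_gbAt_subset _).trans (closedBall_subset_closedBall ?_)
    rw [norm_neg, norm_offH]; norm_num

/-- `profPhi` is a transverse profile. [folklore] -/
theorem isProfile_profPhi : IsProfile profPhi := by
  refine ⟨((contDiff_const.mul (contDiff_gbAt _)).sub (contDiff_gbAt _)).sub (contDiff_gbAt _), ?_⟩
  have h1 : tsupport (fun z => 2 * gbAt offH z) ⊆ closedBall (centre (Fin 2)) (1 / 4) :=
    (tsupport_const_mul_subset 2 (gbAt offH)).trans ((tsupport_gbAt_subset _).trans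
      (closedBall_subset_closedBall (by rw [norm_offH]; norm_num)))
  have h2 : tsupport (gbAt (-offH)) ⊆ closedBall (centre (Fin 2)) (1 / 4) :=
    (tsupport_gbAt_subset _).trans (closedBall_subset_closedBall (by rw [norm_neg, norm_offH]; norm_num))
  have h3 : tsupport (gbAt offV) ⊆ closedBall (centre (Fin 2)) (1 / 4) :=
    (tsupport_gbAt_subset _).trans (closedBall_subset_closedBall (by rw [norm_offV]; norm_num))
  refine (tsupport_sub (fun z => 2 * gbAt offH z - gbAt (-offH) z) (gbAt offV)).trans (union_subset ?_ h3)
  exact (tsupport_sub (fun z => 2 * gbAt offH z) (gbAt (-offH))).trans (union_subset h1 h2)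

/-- The three translates have pairwise disjoint supports (pointwise products vanish). [folklore] -/
theorem translates_disjoint (z : E²) :
    gbAt offH z * gbAt (-offH) z = 0 ∧ gbAt offH z * gbAt offV z = 0 ∧ gbAt (-offH) z * gbAt offV z = 0 :=
  ⟨gbAt_mul_gbAt_eq_zero (by rw [sub_neg_eq_add, norm_offH_add_offH]; norm_num) z,
    gbAt_mul_gbAt_eq_zero norm_offH_sub_offV z, gbAt_mul_gbAt_eq_zero norm_neg_offH_sub_offV z⟩

/-- Integrability of powers `g_v^p`, `p ≥ 1`, of translates (continuous with compact support). [folklore] -/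
theorem integrable_gbAt_pow (v : E²) {p : ℕ} (hp : p ≠ 0) : Integrable fun z => gbAt v z ^ p := by
  have hc : HasCompactSupport (gbAt v) := by
    rw [show gbAt v = gb ∘ Homeomorph.subRight (centre (Fin 2) + v) from funext (gbAt_apply v)]
    exact hasCompactSupport_gb.comp_homeomorph (Homeomorph.subRight (centre (Fin 2) + v))
  exact ((continuous_gbAt v).pow p).integrable_of_hasCompactSupport (hc.comp_left (g := fun x : ℝ => x ^ p) (zero_pow hp))

/-- **Moments of `profR`: `∫ profR = 0`.** [cite: DelellisKwon2022, §3.1 (3.5)] -/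
theorem integral_profR : ∫ z, profR z = 0 := by
  unfold profR
  rw [integral_sub ((integrable_gbAt_pow offH one_ne_zero).congr (by simp)) ((integrable_gbAt_pow (-offH) one_ne_zero).congr (by simp))]
  have h1 := integral_gbAt_pow offH 1
  have h2 := integral_gbAt_pow (-offH) 1
  simp only [pow_one] at h1 h2
  rw [h1, h2, sub_self]

/-- **`∫ profR² = 2 ∫ g² > 0`.** [cite: DelellisKwon2022, §3.1 (3.5)] -/
theorem integral_profR_sq : ∫ z, profR z ^ 2 = 2 * ∫ z, gb z ^ 2 := by
  have hpt : ∀ z, profR z ^ 2 = gbAt offH z ^ 2 + gbAt (-offH) z ^ 2 := fun z => by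
    have := (translates_disjoint z).1
    unfold profR; nlinarith [this]
  simp_rw [hpt]
  rw [integral_add (integrable_gbAt_pow _ two_ne_zero) (integrable_gbAt_pow _ two_ne_zero), integral_gbAt_pow, integral_gbAt_pow]
  ring

/-- **`∫ profR³ = 0`.** [cite: DelellisKwon2022, §3.1 (3.5)] -/
theorem integral_profR_cube : ∫ z, profR z ^ 3 = 0 := by
  have hpt : ∀ z, profR z ^ 3 = gbAt offH z ^ 3 - gbAt (-offH) z ^ 3 := fun z => by
    have := (translates_disjoint z).1
    unfold profR
    have h2 : gbAt offH z ^ 2 * gbAt (-offH) z = 0 := by rw [pow_two, mul_assoc, this, mul_zero]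
    have h3 : gbAt offH z * gbAt (-offH) z ^ 2 = 0 := by rw [pow_two, ← mul_assoc, this, zero_mul]
    nlinarith [h2, h3]
  simp_rw [hpt]
  rw [integral_sub (integrable_gbAt_pow _ three_ne_zero) (integrable_gbAt_pow _ three_ne_zero), integral_gbAt_pow, integral_gbAt_pow, sub_self]

/-- **`∫ profPhi = 0`.** [cite: DelellisKwon2022, §3.1 (3.5)] -/
theorem integral_profPhi : ∫ z, profPhi z = 0 := by
  unfold profPhi
  have i1 : Integrable fun z => 2 * gbAt offH z := ((integrable_gbAt_pow offH one_ne_zero).congr (by simp)).const_mul 2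
  have i2 : Integrable (gbAt (-offH)) := (integrable_gbAt_pow (-offH) one_ne_zero).congr (by simp)
  have i3 : Integrable (gbAt offV) := (integrable_gbAt_pow offV one_ne_zero).congr (by simp)
  rw [integral_sub (f := fun z => 2 * gbAt offH z - gbAt (-offH) z) (g := gbAt offV) (i1.sub i2) i3,
    integral_sub (f := fun z => 2 * gbAt offH z) (g := gbAt (-offH)) i1 i2, integral_const_mul]
  have h1 := integral_gbAt_pow offH 1
  have h2 := integral_gbAt_pow (-offH) 1
  have h3 := integral_gbAt_pow offV 1
  simp only [pow_one] at h1 h2 h3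
  rw [h1, h2, h3, integral_gb]
  norm_num

/-- **`∫ profPhi³ = 6 ∫ g³ > 0`.** [cite: DelellisKwon2022, §3.1 (3.5)] -/
theorem integral_profPhi_cube : ∫ z, profPhi z ^ 3 = 6 * ∫ z, gb z ^ 3 := by
  have hpt : ∀ z, profPhi z ^ 3 = 8 * gbAt offH z ^ 3 - gbAt (-offH) z ^ 3 - gbAt offV z ^ 3 := fun z => by
    obtain ⟨hab, hac, hbc⟩ := translates_disjoint z
    set a := gbAt offH z; set b := gbAt (-offH) z; set c := gbAt offV z
    unfold profPhi
    have e1 : (2 * a - b - c) ^ 3 = 8 * a ^ 3 - b ^ 3 - c ^ 3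
        - 12 * a * (a * b) - 12 * a * (a * c) + 6 * b * (a * b) + 6 * c * (a * c)
        + 12 * c * (a * b) - 3 * b * (b * c) - 3 * c * (b * c) := by ring
    rw [e1, hab, hac, hbc]; ring
  simp_rw [hpt]
  have i1 := integrable_gbAt_pow offH three_ne_zero
  have i2 := integrable_gbAt_pow (-offH) three_ne_zero
  have i3 := integrable_gbAt_pow offV three_ne_zero
  rw [integral_sub (f := fun z => 8 * gbAt offH z ^ 3 - gbAt (-offH) z ^ 3) (g := fun z => gbAt offV z ^ 3)
      ((i1.const_mul 8).sub i2) i3,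
    integral_sub (f := fun z => 8 * gbAt offH z ^ 3) (g := fun z => gbAt (-offH) z ^ 3) (i1.const_mul 8) i2,
    integral_const_mul, integral_gbAt_pow, integral_gbAt_pow, integral_gbAt_pow]
  ring

/-- `∫ profR² > 0`. [folklore] -/
theorem integral_profR_sq_pos : 0 < ∫ z, profR z ^ 2 := by
  rw [integral_profR_sq]; exact mul_pos two_pos (integral_gb_pow_pos two_ne_zero)

/-- `∫ profPhi³ > 0`. [folklore] -/
theorem integral_profPhi_cube_pos : 0 < ∫ z, profPhi z ^ 3 := by
  rw [integral_profPhi_cube]; exact mul_pos (by norm_num) (integral_gb_pow_pos (by norm_num))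

/-! ## The transverse profiles on `𝕋²` -/

/-- The amplitude `κ_R = μ (∫ profR²)^{-1/2}` normalising `∫ transR² = 1`. [folklore] -/
def ampR (μ : ℝ) : ℝ := μ / Real.sqrt (∫ z, profR z ^ 2)

/-- The amplitude `κ_φ = (μ² / ∫ profPhi³)^{1/3}` normalising `∫ transPhi³ = 1`. [folklore] -/
def ampPhi (μ : ℝ) : ℝ := (μ ^ 2 / ∫ z, profPhi z ^ 3) ^ ((1 : ℝ) / 3)

/-- **The `R`-type transverse profile on `𝕋²`** concentrated at scale `1/μ` around `c₀`. [cite: DelellisKwon2022, §3.1 (3.5)–(3.6)] -/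
def transR (μ : ℝ) : UnitAddTorus (Fin 2) → ℝ := conc (ampR μ) 0 μ profR

/-- **The `φ`-type transverse profile on `𝕋²`** concentrated at scale `1/μ` around `c₀`. [cite: DelellisKwon2022, §3.1 (3.5)–(3.6)] -/
def transPhi (μ : ℝ) : UnitAddTorus (Fin 2) → ℝ := conc (ampPhi μ) 0 μ profPhi

variable {μ : ℝ}

/-- `transR` is smooth (`μ ≥ 1`). [folklore] -/
theorem isSmooth_transR (hμ : 1 ≤ μ) : IsSmooth (transR μ) := isSmooth_conc isProfile_profR hμ _ _

/-- `transPhi` is smooth (`μ ≥ 1`). [folklore] -/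
theorem isSmooth_transPhi (hμ : 1 ≤ μ) : IsSmooth (transPhi μ) := isSmooth_conc isProfile_profPhi hμ _ _

/-- `∫_{𝕋²} conc κ 0 μ f₀ ^ p = κ^p μ^{-2} ∫ f₀^p` for `p ≥ 1` (one lattice term per point, then the
`L^p`-scaling of `rescale 0 μ`). [folklore] -/
theorem integral_conc_pow {f₀ : E² → ℝ} (hf : IsProfile f₀) (hμ : 1 ≤ μ) (κ : ℝ) {p : ℕ} (hp : p ≠ 0) :
    ∫ x, conc κ 0 μ f₀ x ^ p = κ ^ p * μ ^ (-(2 : ℝ)) * ∫ z, f₀ z ^ p := by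
  have hμ0 : 0 < μ := by linarith
  rw [integral_comp_conc hf hμ κ 0 (continuous_pow p) (zero_pow hp)]
  have h1 : ∀ z, (κ * rescale 0 μ f₀ z) ^ p = κ ^ p * rescale 0 μ (fun w => f₀ w ^ p) z := fun z => by
    rw [mul_pow, rescale_apply, rescale_apply, Real.rpow_zero, one_mul, one_mul]
  simp_rw [h1]
  rw [integral_const_mul, integral_rescale hμ0, mul_assoc]
  norm_num

/-- **`∫ transR = 0`.** [cite: DelellisKwon2022, §3.1 (3.5)] -/
theorem integral_transR (hμ : 1 ≤ μ) : ∫ x, transR μ x = 0 := by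
  rw [transR, integral_conc isProfile_profR hμ, integral_profR, mul_zero]

/-- **`∫ transR³ = 0`.** [cite: DelellisKwon2022, §3.1 (3.5)] -/
theorem integral_transR_cube (hμ : 1 ≤ μ) : ∫ x, transR μ x ^ 3 = 0 := by
  rw [transR, integral_conc_pow isProfile_profR hμ _ (by norm_num), integral_profR_cube, mul_zero]

/-- **`∫ transR² = 1`.** [cite: DelellisKwon2022, §3.1 (3.5)] -/
theorem integral_transR_sq (hμ : 1 ≤ μ) : ∫ x, transR μ x ^ 2 = 1 := by
  have hμ0 : 0 < μ := by linarith
  have hI := integral_profR_sq_pos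
  rw [transR, integral_conc_pow isProfile_profR hμ _ two_ne_zero, ampR, div_pow, Real.sq_sqrt hI.le,
    Real.rpow_neg hμ0.le, Real.rpow_two]
  field_simp

/-- **`∫ transPhi = 0`.** [cite: DelellisKwon2022, §3.1 (3.5)] -/
theorem integral_transPhi (hμ : 1 ≤ μ) : ∫ x, transPhi μ x = 0 := by
  rw [transPhi, integral_conc isProfile_profPhi hμ, integral_profPhi, mul_zero]

/-- **`∫ transPhi³ = 1`.** [cite: DelellisKwon2022, §3.1 (3.5)] -/
theorem integral_transPhi_cube (hμ : 1 ≤ μ) : ∫ x, transPhi μ x ^ 3 = 1 := by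
  have hμ0 : 0 < μ := by linarith
  have hI := integral_profPhi_cube_pos
  rw [transPhi, integral_conc_pow isProfile_profPhi hμ _ (by norm_num), ampPhi]
  have hbase : 0 ≤ μ ^ 2 / ∫ z, profPhi z ^ 3 := by positivity
  have h3 : ((μ ^ 2 / ∫ z, profPhi z ^ 3) ^ ((1 : ℝ) / 3)) ^ 3 = μ ^ 2 / ∫ z, profPhi z ^ 3 := by
    rw [← Real.rpow_natCast _ 3, ← Real.rpow_mul hbase]; norm_num
  rw [h3, Real.rpow_neg hμ0.le, Real.rpow_two]
  field_simp

/-- **Small support (the hypothesis of the tube lemma)**: if `conc κ 0 μ f₀ x ≠ 0` then `x = proj w`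
with `‖w - c₀‖ ≤ 1/(4μ)`. [cite: DelellisKwon2022, §3.1 (3.6)] -/
theorem exists_lift_of_conc_ne_zero {f₀ : E² → ℝ} (hf : IsProfile f₀) (hμ : 1 ≤ μ) (κ : ℝ)
    {x : UnitAddTorus (Fin 2)} (hx : conc κ 0 μ f₀ x ≠ 0) :
    ∃ w : E², proj w = x ∧ ‖w - centre (Fin 2)‖ ≤ 1 / (4 * μ) := by
  have hμ0 : 0 < μ := by linarith
  refine ⟨repr x, proj_repr x, ?_⟩
  rw [conc_apply hf hμ] at hx
  have hne : rescale 0 μ f₀ (repr x) ≠ 0 := fun h => hx (by rw [h, mul_zero])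
  have hmem := tsupport_rescale_subset hμ0 hf.tsupport_subset 0 (subset_tsupport _ (mem_support.2 hne))
  rw [mem_closedBall, dist_eq_norm] at hmem
  convert hmem using 1
  field_simp

/-- Small support of `transR`. [cite: DelellisKwon2022, §3.1 (3.6)] -/
theorem exists_lift_of_transR_ne_zero (hμ : 1 ≤ μ) {x : UnitAddTorus (Fin 2)} (hx : transR μ x ≠ 0) :
    ∃ w : E², proj w = x ∧ ‖w - centre (Fin 2)‖ ≤ 1 / (4 * μ) :=
  exists_lift_of_conc_ne_zero isProfile_profR hμ _ hx

/-- Small support of `transPhi`. [cite: DelellisKwon2022, §3.1 (3.6)] -/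
theorem exists_lift_of_transPhi_ne_zero (hμ : 1 ≤ μ) {x : UnitAddTorus (Fin 2)} (hx : transPhi μ x ≠ 0) :
    ∃ w : E², proj w = x ∧ ‖w - centre (Fin 2)‖ ≤ 1 / (4 * μ) :=
  exists_lift_of_conc_ne_zero isProfile_profPhi hμ _ hx

end DLK

end Literature.Analysis.FluidPDE
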